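import Mathlib.Probability.Distributions.Gaussian.Real
import Mathlib.Analysis.SpecialFunctions.Gaussian.GaussianIntegral
import HarnessLib

/-!
# Route `ColdStartUniversality`, crux K_A1 (stmt-QuantumFields-24809), `L²` twin of line «cold_entropy»: the ONE-MODE χ² — the exact
# χ²-divergence between centred Gaussians and the Ornstein–Uhlenbeck cold-start bound `χ² ≤ e^{-4κs}/(2(1 − e^{-4κs}))`

Helper file (seat `ym-line-csu-p1`, g16; `--supports stmt-QuantumFields-24809`).  The `L²` analogue of the registered support node
`stub_ouModeEntropy` (one-mode OU ENTROPY, g4): the per-mode input of the free-field heuristic for hypothesis (H2) of `chiSquareStep`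
(K-uniform cold-start χ² budget) — doubly exponentially small in the relaxation rate, so that the Weyl-law sum over the momentum box
(`stub_weylEntropySum`, landed) is K-uniform exactly as for the entropy budget.

* `sq_gaussianPDFReal_div` — `p₁²/p₀ = C e^{-b x²}` for centred Gaussian densities (`C = √(2πv)/(2πv₁)`, `b = 1/v₁ − 1/(2v)`);
* ★ `integral_sq_gaussianPDFReal_div` — `∫ p₁²/p₀ dx = v/√(v₁(2v − v₁))` for `0 < v₁ < 2v`;
* ★ `chiSq_gaussianReal_centred` — `∫⁻ (dN(0,v₁)/dN(0,v) − 1)² dN(0,v) = v/√(v₁(2v−v₁)) − 1` (as `ENNReal.ofReal`);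
* ★★ `ouModeChiSquare` — for the OU mode started at `0` (law `N(0, v(1 − e^{-2κs}))` at time `s`, equilibrium `N(0,v)`):
  `χ² = (1 − e^{-4κs})^{-1/2} − 1 ≤ e^{-4κs}/(2(1 − e^{-4κs}))`.

THEOREMS ONLY, no definition, no sorry; pure probability (Mathlib Gaussians).  HONEST FRAMING: a one-dimensional Gaussian computation;
nothing about Yang–Mills is proved here; the Yang–Mills mass gap is NOT proved.
-/

set_option autoImplicit false

noncomputable section

namespace Summit.QuantumFields.YangMills.Theorems.ColdStartUniversality

open MeasureTheory ProbabilityTheory Real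
open scoped NNReal ENNReal

/-- `p₁(x)²/p₀(x) = C · e^{-b x²}` for the centred Gaussian densities of variances `v₁, v > 0`, with `C = √(2πv)/(2πv₁)` and
`b = 1/v₁ − 1/(2v)`. [folklore] -/
theorem sq_gaussianPDFReal_div {v₁ v : ℝ≥0} (hv₁ : v₁ ≠ 0) (hv : v ≠ 0) (x : ℝ) :
    (gaussianPDFReal 0 v₁ x) ^ 2 / gaussianPDFReal 0 v x =
      (√(2 * π * v) / (2 * π * v₁)) * rexp (-((1 / (v₁ : ℝ) - 1 / (2 * v)) * x ^ 2)) := by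
  have hv₁' : (0 : ℝ) < v₁ := by exact_mod_cast pos_iff_ne_zero.2 hv₁
  have hv' : (0 : ℝ) < v := by exact_mod_cast pos_iff_ne_zero.2 hv
  have h2πv₁ : 0 < 2 * π * (v₁ : ℝ) := by positivity
  have h2πv : 0 < 2 * π * (v : ℝ) := by positivity
  simp only [gaussianPDFReal_def, sub_zero]
  have hs₁ : (√(2 * π * v₁)) ^ 2 = 2 * π * v₁ := Real.sq_sqrt h2πv₁.le
  have hsv : √(2 * π * (v : ℝ)) ≠ 0 := (Real.sqrt_pos.2 h2πv).ne'
  have hsv₁ : √(2 * π * (v₁ : ℝ)) ≠ 0 := (Real.sqrt_pos.2 h2πv₁).ne'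
  have hexp : rexp (-x ^ 2 / (2 * v₁)) ^ 2 / rexp (-x ^ 2 / (2 * v)) = rexp (-((1 / (v₁ : ℝ) - 1 / (2 * v)) * x ^ 2)) := by
    rw [← Real.exp_nat_mul, ← Real.exp_sub]
    congr 1
    field_simp
    ring
  rw [mul_pow, inv_pow, hs₁]
  rw [show ((2 * π * (v₁ : ℝ)))⁻¹ * rexp (-x ^ 2 / (2 * ↑v₁)) ^ 2 / ((√(2 * π * ↑v))⁻¹ * rexp (-x ^ 2 / (2 * ↑v))) =
      (√(2 * π * ↑v) / (2 * π * ↑v₁)) * (rexp (-x ^ 2 / (2 * ↑v₁)) ^ 2 / rexp (-x ^ 2 / (2 * ↑v))) by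
    field_simp]
  rw [hexp]

/-- ★ **`∫ p₁²/p₀ dx = v / √(v₁ (2v − v₁))`** for centred Gaussian densities with `0 < v₁ < 2v`. [folklore] -/
theorem integral_sq_gaussianPDFReal_div {v₁ v : ℝ≥0} (hv₁ : v₁ ≠ 0) (hv : v ≠ 0) (h2 : (v₁ : ℝ) < 2 * v) :
    ∫ x, (gaussianPDFReal 0 v₁ x) ^ 2 / gaussianPDFReal 0 v x = (v : ℝ) / √((v₁ : ℝ) * (2 * v - v₁)) := by
  have hv₁' : (0 : ℝ) < v₁ := by exact_mod_cast pos_iff_ne_zero.2 hv₁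
  have hv' : (0 : ℝ) < v := by exact_mod_cast pos_iff_ne_zero.2 hv
  set b : ℝ := 1 / (v₁ : ℝ) - 1 / (2 * v) with hb
  have hbpos : 0 < b := by
    rw [hb, div_sub_div _ _ hv₁'.ne' (by positivity), one_mul, mul_one]
    exact div_pos (by linarith) (by positivity)
  set C : ℝ := √(2 * π * v) / (2 * π * v₁) with hC
  have hCpos : 0 < C := by rw [hC]; positivity
  simp_rw [sq_gaussianPDFReal_div hv₁ hv]
  have e : (fun a : ℝ => rexp (-((1 / (v₁ : ℝ) - 1 / (2 * v)) * a ^ 2))) = fun a => rexp (-b * a ^ 2) := by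
    funext a; rw [hb, neg_mul]
  rw [integral_const_mul, e, integral_gaussian b]
  -- `C √(π/b) = v/√(v₁(2v − v₁))`: compare squares of positive numbers
  have hD : 0 < (v₁ : ℝ) * (2 * v - v₁) := mul_pos hv₁' (by linarith)
  have hlhs : 0 < C * √(π / b) := mul_pos hCpos (Real.sqrt_pos.2 (div_pos Real.pi_pos hbpos))
  have hrhs : 0 < (v : ℝ) / √((v₁ : ℝ) * (2 * v - v₁)) := div_pos hv' (Real.sqrt_pos.2 hD)
  rw [← Real.sqrt_sq hlhs.le, ← Real.sqrt_sq hrhs.le]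
  congr 1
  rw [mul_pow, Real.sq_sqrt (div_pos Real.pi_pos hbpos).le, hC, div_pow,
    Real.sq_sqrt (by positivity : (0 : ℝ) ≤ 2 * π * v), div_pow, Real.sq_sqrt hD.le, hb]
  field_simp

/-- ★ **The χ²-divergence between centred Gaussians**: for `0 < v₁ < 2v`,
`∫ (dN(0,v₁)/dN(0,v) − 1)² dN(0,v) = v/√(v₁(2v − v₁)) − 1`. [folklore] -/
theorem chiSq_gaussianReal_centred {v₁ v : ℝ≥0} (hv₁ : v₁ ≠ 0) (hv : v ≠ 0) (h2 : (v₁ : ℝ) < 2 * v) :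
    ∫⁻ y, ENNReal.ofReal ((((gaussianReal 0 v₁).rnDeriv (gaussianReal 0 v) y).toReal - 1) ^ 2) ∂(gaussianReal 0 v) =
      ENNReal.ofReal ((v : ℝ) / √((v₁ : ℝ) * (2 * v - v₁)) - 1) := by
  have hv₁' : (0 : ℝ) < v₁ := by exact_mod_cast pos_iff_ne_zero.2 hv₁
  have hv' : (0 : ℝ) < v := by exact_mod_cast pos_iff_ne_zero.2 hv
  set N₁ : Measure ℝ := gaussianReal 0 v₁ with hN₁
  set N₀ : Measure ℝ := gaussianReal 0 v with hN₀
  set p₁ : ℝ → ℝ := gaussianPDFReal 0 v₁ with hp₁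
  set p₀ : ℝ → ℝ := gaussianPDFReal 0 v with hp₀
  have hp₀pos : ∀ y, 0 < p₀ y := fun y => gaussianPDFReal_pos 0 v y hv
  have hp₁nn : ∀ y, 0 ≤ p₁ y := fun y => gaussianPDFReal_nonneg 0 v₁ y
  -- the density `h = dN₁/dN₀ = p₁/p₀` Lebesgue-a.e.
  have hN₀ρ : N₀ = volume.withDensity (gaussianPDF 0 v) := gaussianReal_of_var_ne_zero 0 hv
  have hrn : N₁.rnDeriv N₀ =ᵐ[volume] fun y => (gaussianPDF 0 v y)⁻¹ * gaussianPDF 0 v₁ y := by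
    have h1 : N₁.rnDeriv N₀ =ᵐ[volume] fun y => (gaussianPDF 0 v y)⁻¹ * N₁.rnDeriv volume y := by
      rw [hN₀ρ]
      exact Measure.rnDeriv_withDensity_right N₁ volume (measurable_gaussianPDF 0 v).aemeasurable
        (ae_of_all _ fun y => (gaussianPDF_pos 0 hv y).ne') (ae_of_all _ fun y => gaussianPDF_ne_top)
    have h2 : N₁.rnDeriv volume =ᵐ[volume] gaussianPDF 0 v₁ := rnDeriv_gaussianReal 0 v₁
    filter_upwards [h1, h2] with y hy1 hy2
    rw [hy1, hy2]
  -- the integrand against Lebesgue measure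
  set g : ℝ → ℝ≥0∞ := fun y => ENNReal.ofReal (((N₁.rnDeriv N₀ y).toReal - 1) ^ 2) with hg
  have hmeas : Measurable g :=
    ((Measure.measurable_rnDeriv _ _).ennreal_toReal.sub measurable_const).pow_const 2 |>.ennreal_ofReal
  have hlin : ∫⁻ y, g y ∂N₀ = ∫⁻ y, (gaussianPDF 0 v * g) y ∂(volume : Measure ℝ) := by
    rw [hN₀ρ]
    exact lintegral_withDensity_eq_lintegral_mul _ (measurable_gaussianPDF 0 v) hmeas
  rw [hlin]
  have hae : (fun y => (gaussianPDF 0 v * g) y) =ᵐ[volume]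
      fun y => ENNReal.ofReal ((p₁ y) ^ 2 / p₀ y - 2 * p₁ y + p₀ y) := by
    filter_upwards [hrn] with y hy
    simp only [Pi.mul_apply, hg]
    rw [hy, gaussianPDF, gaussianPDF, ENNReal.toReal_mul, ENNReal.toReal_inv, ENNReal.toReal_ofReal (hp₀pos y).le,
      ENNReal.toReal_ofReal (hp₁nn y), ← ENNReal.ofReal_mul (hp₀pos y).le]
    congr 1
    have hp0 : gaussianPDFReal 0 v y ≠ 0 := (hp₀pos y).ne'
    show gaussianPDFReal 0 v y * ((gaussianPDFReal 0 v y)⁻¹ * gaussianPDFReal 0 v₁ y - 1) ^ 2 =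
      gaussianPDFReal 0 v₁ y ^ 2 / gaussianPDFReal 0 v y - 2 * gaussianPDFReal 0 v₁ y + gaussianPDFReal 0 v y
    field_simp
    ring
  rw [lintegral_congr_ae hae]
  -- integrability of the three pieces and evaluation
  have hb : 0 < 1 / (v₁ : ℝ) - 1 / (2 * v) := by
    rw [div_sub_div _ _ hv₁'.ne' (by positivity), one_mul, mul_one]
    exact div_pos (by linarith) (by positivity)
  have hI1 : Integrable (fun y => (p₁ y) ^ 2 / p₀ y) := by
    have e : (fun y => (p₁ y) ^ 2 / p₀ y) = fun y =>
        (√(2 * π * v) / (2 * π * v₁)) * rexp (-((1 / (v₁ : ℝ) - 1 / (2 * v)) * y ^ 2)) := by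
      funext y; exact sq_gaussianPDFReal_div hv₁ hv y
    rw [e]
    have h := (integrable_exp_neg_mul_sq hb).const_mul (√(2 * π * v) / (2 * π * v₁))
    refine h.congr (ae_of_all _ fun y => ?_)
    simp only [neg_mul]
  have hI₁ : Integrable p₁ := integrable_gaussianPDFReal 0 v₁
  have hI₀ : Integrable p₀ := integrable_gaussianPDFReal 0 v
  have hInt : Integrable (fun y => (p₁ y) ^ 2 / p₀ y - 2 * p₁ y + p₀ y) := (hI1.sub (hI₁.const_mul 2)).add hI₀
  have hnn : ∀ y, 0 ≤ (p₁ y) ^ 2 / p₀ y - 2 * p₁ y + p₀ y := by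
    intro y
    have hp0 : 0 < p₀ y := hp₀pos y
    have e : (p₁ y) ^ 2 / p₀ y - 2 * p₁ y + p₀ y = (p₁ y - p₀ y) ^ 2 / p₀ y := by
      field_simp; ring
    rw [e]; positivity
  rw [← ofReal_integral_eq_lintegral_ofReal hInt (ae_of_all _ hnn)]
  congr 1
  have i12 : Integrable (fun y => (p₁ y) ^ 2 / p₀ y - 2 * p₁ y) := hI1.sub (hI₁.const_mul 2)
  rw [integral_add i12 hI₀, integral_sub hI1 (hI₁.const_mul 2), integral_const_mul,
    integral_sq_gaussianPDFReal_div hv₁ hv h2]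
  rw [hp₁, hp₀, integral_gaussianPDFReal_eq_one 0 hv₁, integral_gaussianPDFReal_eq_one 0 hv]
  ring

/-- `(1 − u)^{-1/2} − 1 ≤ u / (2(1 − u))` for `0 ≤ u < 1`. [folklore] -/
theorem inv_sqrt_one_sub_sub_one_le {u : ℝ} (hu0 : 0 ≤ u) (hu1 : u < 1) :
    1 / √(1 - u) - 1 ≤ u / (2 * (1 - u)) := by
  set w : ℝ := √(1 - u) with hw
  have h1u : 0 < 1 - u := by linarith
  have hwpos : 0 < w := Real.sqrt_pos.2 h1u
  have hw1 : w ≤ 1 :=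
    calc w = √(1 - u) := hw
      _ ≤ √1 := Real.sqrt_le_sqrt (by linarith)
      _ = 1 := Real.sqrt_one
  have hw2 : w ^ 2 = 1 - u := Real.sq_sqrt h1u.le
  rw [show u / (2 * (1 - u)) = (1 - w ^ 2) / (2 * w ^ 2) by rw [hw2]; ring_nf]
  rw [div_sub_one hwpos.ne', div_le_div_iff₀ hwpos (by positivity)]
  nlinarith [mul_nonneg hwpos.le (sq_nonneg (1 - w))]

/-- ★★ **The one-mode Ornstein–Uhlenbeck χ²** (the `L²` twin of the registered `stub_ouModeEntropy`): the OU mode `dX = −κX ds + σ dB`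
started at `0` has law `N(0, v(1 − e^{−2κs}))` at time `s` (`v = σ²/2κ`), and its χ²-divergence from equilibrium `N(0,v)` is
`(1 − e^{−4κs})^{−1/2} − 1 ≤ e^{−4κs}/(2(1 − e^{−4κs}))` — DOUBLY exponentially small in the relaxation rate, like the entropy.
[folklore] -/
theorem ouModeChiSquare (v : ℝ≥0) (hv : v ≠ 0) (κ s : ℝ) (hκ : 0 < κ) (hs : 0 < s) :
    ∫⁻ y, ENNReal.ofReal ((((gaussianReal 0 (((v : ℝ) * (1 - rexp (-(2 * κ * s)))).toNNReal)).rnDeriv (gaussianReal 0 v) y).toReal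
        - 1) ^ 2) ∂(gaussianReal 0 v) ≤
      ENNReal.ofReal (rexp (-(4 * κ * s)) / (2 * (1 - rexp (-(4 * κ * s))))) := by
  have hv' : (0 : ℝ) < v := by exact_mod_cast pos_iff_ne_zero.2 hv
  set x : ℝ := rexp (-(2 * κ * s)) with hx
  have hx0 : 0 < x := Real.exp_pos _
  have hx1 : x < 1 := by
    rw [hx]
    exact Real.exp_lt_one_iff.2 (by nlinarith [mul_pos hκ hs])
  have hx2 : x ^ 2 = rexp (-(4 * κ * s)) := by
    rw [hx, ← Real.exp_nat_mul]; congr 1; ring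
  -- the variance at time `s`
  have hvx : 0 < (v : ℝ) * (1 - x) := mul_pos hv' (by linarith)
  set v₁ : ℝ≥0 := ((v : ℝ) * (1 - x)).toNNReal with hv₁
  have hv₁r : (v₁ : ℝ) = v * (1 - x) := Real.coe_toNNReal _ hvx.le
  have hv₁ne : v₁ ≠ 0 := by
    intro h0
    have : (v₁ : ℝ) = 0 := by rw [h0]; rfl
    rw [hv₁r] at this
    exact hvx.ne' this
  have h2 : (v₁ : ℝ) < 2 * v := by rw [hv₁r]; nlinarith
  rw [chiSq_gaussianReal_centred hv₁ne hv h2, hv₁r]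
  refine ENNReal.ofReal_le_ofReal ?_
  -- `v/√(v(1−x)(2v − v(1−x))) = 1/√(1 − x²)`
  have h1x2 : 0 < 1 - x ^ 2 := by nlinarith
  have hsimp : (v : ℝ) / √((v : ℝ) * (1 - x) * (2 * v - v * (1 - x))) = 1 / √(1 - x ^ 2) := by
    have e : (v : ℝ) * (1 - x) * (2 * v - v * (1 - x)) = (v : ℝ) ^ 2 * (1 - x ^ 2) := by ring
    rw [e, Real.sqrt_mul (sq_nonneg _), Real.sqrt_sq hv'.le]
    field_simp
  rw [hsimp, ← hx2]
  exact inv_sqrt_one_sub_sub_one_le (sq_nonneg x) (by nlinarith)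

end Summit.QuantumFields.YangMills.Theorems.ColdStartUniversality

end
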